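import Mathlib
import Summits.CriticalPhenomena.PercolationContinuityZ3.Theorems.PercNearOneGluingNoHeavyLowerTailSahiCombTriWShell

/-!
# `TRI_W(a)` in DIPOLE form: demand/supply tokens, and "ANY rank certificate on the containment relation ⟹ `TriWIneq`"

Support file of the one-cut programme (crux `NoHeavyLowerTail`, stmt-CriticalPhenomena-4575; lemma factory `prim-lf-1`, gen 32; memo
`FROM-prim-lf-1-gen32-TRANSLATE-RANK-AND-TILT.md` §1, §3).  P5's symmetric master form (`…SahiCombTriWTranslate`, memo SYMMETRIC-MASTER-FORM §4)
turns the triangle functional into a Hall/matching problem ("dipole form").  For the tree's `triW P F G` (index cube `Finset β`, fibre cube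
`Finset γ`, `P` an up-set, `F, G` monotone families of up-sets) the dictionary is, level by level (`x : Finset β`, `refl` = antipode):

* DEMAND tokens: `D₁(x) = refl P ∩ F x`, `D₂(x) = P ∩ refl (F xᶜ)`, `D₃(x) = refl P ∩ refl (F xᶜ)`;
* SUPPLY tokens: `A(x) = B(x) = P ∩ F x` (two copies), `E(x) = refl P ∩ F xᶜ`;
* a token `(v,d)` may be sent to `(w,u)` iff `v ⊆ w` and `d ⊆ u` (upward in the product cube);

and the COUNT IDENTITY (`triW_eq_card_sup_sub_card_dem`): for every family `G`,
`triW P F G = Σ_x [2·#(A(x) ∩ G x) + #(E(x) ∩ G x)] − Σ_x [#(D₁(x) ∩ G x) + #(D₂(x) ∩ G x) + #(D₃(x) ∩ G x)]`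
(three of the five terms of `triWTerm` are re-indexed `x ↦ xᶜ` and reflected).  Hence (`triW_nonneg_of_dipoleRankCert`): if SOME matrix `K`
supported on the containment relation (rows = demand tokens, columns = supply tokens) has linearly independent rows — a RANK
CERTIFICATE — then `0 ≤ triW P F G` for EVERY monotone up-set family `G`: the rows of tokens inside `G` are supported on columns
inside `G`, so they stay independent after restriction, and their number is at most the number of columns inside `G`.  Consequently
(`triWIneq_of_dipoleRankCert`) a rank certificate for every `(P, F)` proves `TriWIneq`.  This is the certificate-level form of
`triWIneq_of_translateIneq`; the candidate certificate of the memo (§3: plain zeta on `D₁→A, D₂→B, D₃→E`, `x`-tilted zeta `[d ⊆ u]·x^{#(u\d)}` on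
`D₁→B, D₃→A`, generic `x`; full row rank verified exhaustively for `#β + #γ ≤ 4` and on 4·10⁵ samples at `5`) is NOT asserted here.
HONEST LABEL: definitions, a counting identity and a conditional reduction, all proved (std axioms); no certificate is proved, `TriWIneq` stays OPEN.
[this work]
-/

namespace Summit.CriticalPhenomena.PercolationContinuityZ3.Theorems

namespace FiveUpSet

open Finset

variable {β γ : Type} [DecidableEq β] [Fintype β] [DecidableEq γ] [Fintype γ]

/-! ### Tokens -/

/-- A token: a tag `i : Fin 3` (demand class `D₁, D₂, D₃` / supply class `A, B, E`), a level `x : Finset β` and a point `u : Finset γ`. [this work] -/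
abbrev Token (β γ : Type) := Fin 3 × (Finset β × Finset γ)

/-- The demand sets of the dipole form at level `v`: `D₁(v) = refl P ∩ F v`, `D₂(v) = P ∩ refl (F vᶜ)`, `D₃(v) = refl P ∩ refl (F vᶜ)`. [this work] -/
def demSet (P : Finset (Finset γ)) (F : Finset β → Finset (Finset γ)) (i : Fin 3) (v : Finset β) : Finset (Finset γ) :=
  if i = 0 then refl P ∩ F v else if i = 1 then P ∩ refl (F vᶜ) else refl P ∩ refl (F vᶜ)

/-- The supply sets of the dipole form at level `w`: `A(w) = B(w) = P ∩ F w` (tags `0, 1`), `E(w) = refl P ∩ F wᶜ` (tag `2`). [this work] -/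
def supSet (P : Finset (Finset γ)) (F : Finset β → Finset (Finset γ)) (j : Fin 3) (w : Finset β) : Finset (Finset γ) :=
  if j = 2 then refl P ∩ F wᶜ else P ∩ F w

/-- The demand tokens. [this work] -/
def dipoleDem (P : Finset (Finset γ)) (F : Finset β → Finset (Finset γ)) : Finset (Token β γ) :=
  univ.filter (fun t => t.2.2 ∈ demSet P F t.1 t.2.1)

/-- The supply tokens. [this work] -/
def dipoleSup (P : Finset (Finset γ)) (F : Finset β → Finset (Finset γ)) : Finset (Token β γ) :=
  univ.filter (fun t => t.2.2 ∈ supSet P F t.1 t.2.1)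

/-! A RANK CERTIFICATE for the dipole form of `triW P F ·` is a matrix `K` on (demand tokens) × (supply tokens), supported on the containment
relation of the product cube (`K r c ≠ 0 → r ≤ c`), whose ROWS are linearly independent over `ℚ`; below it is passed as the triple `(K, hK, hli)`. -/

/-! ### Counting tokens inside a test family -/

omit [DecidableEq β] in
/-- Tokens of a level-indexed family of sets, restricted to a test family `G`, counted level by level. [this work] -/
theorem card_filter_token (S : Fin 3 → Finset β → Finset (Finset γ)) (G : Finset β → Finset (Finset γ)) :
    ((univ : Finset (Token β γ)).filter (fun t => t.2.2 ∈ S t.1 t.2.1 ∧ t.2.2 ∈ G t.2.1)).card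
      = ∑ x : Finset β, ((S 0 x ∩ G x).card + (S 1 x ∩ G x).card + (S 2 x ∩ G x).card) := by
  rw [card_filter, Fintype.sum_prod_type, Fin.sum_univ_three]
  have h : ∀ i : Fin 3, ∑ p : Finset β × Finset γ, (if p.2 ∈ S i p.1 ∧ p.2 ∈ G p.1 then 1 else 0)
      = ∑ x : Finset β, (S i x ∩ G x).card := by
    intro i
    rw [Fintype.sum_prod_type]
    refine sum_congr rfl fun x _ => ?_
    rw [← card_filter]
    congr 1
    ext u
    simp [mem_inter]
  rw [h 0, h 1, h 2, ← sum_add_distrib, ← sum_add_distrib]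

/-! ### The count identity -/

omit [DecidableEq β] [Fintype β] in
/-- `#(P ∩ refl A ∩ refl B) = #(refl P ∩ A ∩ B)` (reflection of `card_refl_inter_inter`). [this work] -/
theorem card_inter_refl_refl (P A B : Finset (Finset γ)) : (P ∩ refl A ∩ refl B).card = (refl P ∩ A ∩ B).card :=
  (card_refl_inter_inter P A B).symm

/-- Re-indexing a level sum by `x ↦ xᶜ`. [folklore] -/
theorem sum_compl_reindex (f : Finset β → ℤ) : ∑ x : Finset β, f xᶜ = ∑ x : Finset β, f x :=
  Fintype.sum_equiv (complEquiv β) _ _ (fun x => by simp [complEquiv])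

/-- **COUNT IDENTITY (dipole form of `triW`).**  For any `P, F, G`:
`triW P F G = Σ_x [2·#(P ∩ F x ∩ G x) + #(refl P ∩ F xᶜ ∩ G x)] − Σ_x [#(refl P ∩ F x ∩ G x) + #(P ∩ refl (F xᶜ) ∩ G x) + #(refl P ∩ refl (F xᶜ) ∩ G x)]`
— supplies minus demands of the dipole form, counted inside `G`. [this work] -/
theorem triW_eq_sup_sub_dem (P : Finset (Finset γ)) (F G : Finset β → Finset (Finset γ)) :
    triW P F G
      = (∑ x : Finset β, (2 * ((P ∩ F x ∩ G x).card : ℤ) + (refl P ∩ F xᶜ ∩ G x).card))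
        - ∑ x : Finset β, (((refl P ∩ F x ∩ G x).card : ℤ) + (P ∩ refl (F xᶜ) ∩ G x).card
            + (refl P ∩ refl (F xᶜ) ∩ G x).card) := by
  unfold triW triWTerm
  -- the five level sums
  have t2 : ∑ x : Finset β, ((P ∩ refl (F x) ∩ G xᶜ).card : ℤ) = ∑ x : Finset β, ((P ∩ refl (F xᶜ) ∩ G x).card : ℤ) := by
    rw [← sum_compl_reindex (fun x => ((P ∩ refl (F xᶜ) ∩ G x).card : ℤ))]
    simp only [compl_compl]
  have t3 : ∑ x : Finset β, ((P ∩ F x ∩ refl (G xᶜ)).card : ℤ) = ∑ x : Finset β, ((refl P ∩ refl (F xᶜ) ∩ G x).card : ℤ) := by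
    rw [← sum_compl_reindex (fun x => ((refl P ∩ refl (F xᶜ) ∩ G x).card : ℤ))]
    simp only [compl_compl]
    refine sum_congr rfl fun x _ => ?_
    rw [← card_refl (P ∩ F x ∩ refl (G xᶜ)), refl_inter, refl_inter, refl_refl]
  have t4 : ∀ x : Finset β, ((P ∩ refl (F x) ∩ refl (G x)).card : ℤ) = (refl P ∩ F x ∩ G x).card := by
    intro x
    rw [card_inter_refl_refl]
  have t5 : ∑ x : Finset β, ((P ∩ refl (F x) ∩ refl (G xᶜ)).card : ℤ) = ∑ x : Finset β, ((refl P ∩ F xᶜ ∩ G x).card : ℤ) := by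
    rw [← sum_compl_reindex (fun x => ((refl P ∩ F xᶜ ∩ G x).card : ℤ))]
    simp only [compl_compl]
    refine sum_congr rfl fun x _ => ?_
    rw [card_inter_refl_refl]
  -- assemble
  have split : ∑ x : Finset β, (2 * ((P ∩ F x ∩ G x).card : ℤ) - (P ∩ refl (F x) ∩ G xᶜ).card - (P ∩ F x ∩ refl (G xᶜ)).card
      - (P ∩ refl (F x) ∩ refl (G x)).card + (P ∩ refl (F x) ∩ refl (G xᶜ)).card)
      = ∑ x : Finset β, 2 * ((P ∩ F x ∩ G x).card : ℤ) - ∑ x : Finset β, ((P ∩ refl (F x) ∩ G xᶜ).card : ℤ)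
        - ∑ x : Finset β, ((P ∩ F x ∩ refl (G xᶜ)).card : ℤ) - ∑ x : Finset β, ((P ∩ refl (F x) ∩ refl (G x)).card : ℤ)
        + ∑ x : Finset β, ((P ∩ refl (F x) ∩ refl (G xᶜ)).card : ℤ) := by
    simp only [sum_add_distrib, sum_sub_distrib]
  rw [split, t2, t3, t5, sum_congr rfl (fun x _ => t4 x)]
  simp only [sum_add_distrib, ← mul_sum]
  ring

/-! ### A rank certificate proves `triW ≥ 0` -/

/-- The restriction of the certificate rows to the demand tokens inside `G` and the supply columns inside `G` is still linearly independent: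
a row `(v,d)` with `d ∈ G v` is supported on columns `(w,u) ≥ (v,d)`, which lie in `G` when `G` is a monotone family of up-sets. [this work] -/
theorem linearIndependent_restrict_of_cert (P : Finset (Finset γ)) (F G : Finset β → Finset (Finset γ))
    (hG : ∀ x, IsUpperSet (G x : Set (Finset γ))) (hGm : Monotone G)
    (K : Token β γ → Token β γ → ℚ) (hK : ∀ r c, K r c ≠ 0 → r.2.1 ⊆ c.2.1 ∧ r.2.2 ⊆ c.2.2)
    (hli : LinearIndependent ℚ (fun r : ↥(dipoleDem P F) => fun c : ↥(dipoleSup P F) => K r c)) :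
    LinearIndependent ℚ
      (fun r : ↥((dipoleDem P F).filter (fun t => t.2.2 ∈ G t.2.1)) =>
        fun c : ↥((dipoleSup P F).filter (fun t => t.2.2 ∈ G t.2.1)) => K r c) := by
  -- rows inside `G`, all columns: a sub-family of an independent family
  let ι : ↥((dipoleDem P F).filter (fun t => t.2.2 ∈ G t.2.1)) → ↥(dipoleDem P F) :=
    fun r => ⟨r.1, (mem_filter.1 r.2).1⟩
  have hι : Function.Injective ι := by
    intro r s h
    apply Subtype.ext
    have h' := congrArg Subtype.val h
    exact h'
  have hli' := hli.comp ι hι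
  rw [Fintype.linearIndependent_iff] at hli' ⊢
  intro g hg
  apply hli' g
  funext c
  rw [Finset.sum_apply]
  simp only [Pi.smul_apply, smul_eq_mul, Pi.zero_apply, Function.comp_apply]
  by_cases hc : c.1.2.2 ∈ G c.1.2.1
  · have h := congrFun hg ⟨c.1, mem_filter.2 ⟨c.2, hc⟩⟩
    rw [Finset.sum_apply] at h
    simpa only [Pi.smul_apply, smul_eq_mul, Pi.zero_apply] using h
  · refine sum_eq_zero fun r _ => ?_
    by_cases hz : K (ι r) c = 0
    · rw [hz, mul_zero]
    · exfalso
      obtain ⟨h1, h2⟩ := hK _ _ hz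
      have hr : (r.1).2.2 ∈ G (r.1).2.1 := (mem_filter.1 r.2).2
      exact hc (hGm h1 (hG _ h2 hr))

/-- **A rank certificate proves `triW P F G ≥ 0` for every monotone family of up-sets `G`.**  `K` is any matrix on tokens supported on the
containment relation (`K r c ≠ 0 → r.2.1 ⊆ c.2.1 ∧ r.2.2 ⊆ c.2.2`) whose rows (demand tokens `dipoleDem P F`) are linearly independent as vectors on the
supply tokens `dipoleSup P F`. [this work] -/
theorem triW_nonneg_of_dipoleRankCert (P : Finset (Finset γ)) (F G : Finset β → Finset (Finset γ))
    (hG : ∀ x, IsUpperSet (G x : Set (Finset γ))) (hGm : Monotone G)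
    (K : Token β γ → Token β γ → ℚ) (hK : ∀ r c, K r c ≠ 0 → r.2.1 ⊆ c.2.1 ∧ r.2.2 ⊆ c.2.2)
    (hli : LinearIndependent ℚ (fun r : ↥(dipoleDem P F) => fun c : ↥(dipoleSup P F) => K r c)) :
    0 ≤ triW P F G := by
  have hliG := linearIndependent_restrict_of_cert P F G hG hGm K hK hli
  have hcard := hliG.fintype_card_le_finrank
  rw [Module.finrank_fintype_fun_eq_card, Fintype.card_coe, Fintype.card_coe] at hcard
  -- the two token counts
  have hdem : ((dipoleDem P F).filter (fun t => t.2.2 ∈ G t.2.1)).card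
      = ∑ x : Finset β, ((refl P ∩ F x ∩ G x).card + (P ∩ refl (F xᶜ) ∩ G x).card + (refl P ∩ refl (F xᶜ) ∩ G x).card) := by
    unfold dipoleDem
    rw [filter_filter, card_filter_token (demSet P F) G]
    refine sum_congr rfl fun x _ => ?_
    simp [demSet]
  have hsup : ((dipoleSup P F).filter (fun t => t.2.2 ∈ G t.2.1)).card
      = ∑ x : Finset β, ((P ∩ F x ∩ G x).card + (P ∩ F x ∩ G x).card + (refl P ∩ F xᶜ ∩ G x).card) := by
    unfold dipoleSup
    rw [filter_filter, card_filter_token (supSet P F) G]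
    refine sum_congr rfl fun x _ => ?_
    simp [supSet]
  rw [hdem, hsup] at hcard
  rw [triW_eq_sup_sub_dem]
  have hcast : ((∑ x : Finset β, ((refl P ∩ F x ∩ G x).card + (P ∩ refl (F xᶜ) ∩ G x).card
      + (refl P ∩ refl (F xᶜ) ∩ G x).card) : ℕ) : ℤ)
      ≤ ((∑ x : Finset β, ((P ∩ F x ∩ G x).card + (P ∩ F x ∩ G x).card + (refl P ∩ F xᶜ ∩ G x).card) : ℕ) : ℤ) := by
    exact_mod_cast hcard
  push_cast at hcast
  have e1 : ∑ x : Finset β, (((P ∩ F x ∩ G x).card : ℤ) + (P ∩ F x ∩ G x).card + (refl P ∩ F xᶜ ∩ G x).card)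
      = ∑ x : Finset β, (2 * ((P ∩ F x ∩ G x).card : ℤ) + (refl P ∩ F xᶜ ∩ G x).card) := by
    refine sum_congr rfl fun x _ => ?_
    ring
  rw [e1] at hcast
  linarith

/-- **Rank certificates for every configuration prove `TriWIneq`** (the certificate-level form of `triWIneq_of_translateIneq`): if for every up-set `P`
and every monotone family of up-sets `F` some matrix supported on the containment relation has independent demand rows, then `TriWIneq`. [this work] -/
theorem triWIneq_of_dipoleRankCert
    (h : ∀ (β γ : Type) [DecidableEq β] [Fintype β] [DecidableEq γ] [Fintype γ]
      (P : Finset (Finset γ)) (F : Finset β → Finset (Finset γ)),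
      IsUpperSet (P : Set (Finset γ)) → (∀ x, IsUpperSet (F x : Set (Finset γ))) → Monotone F →
        ∃ K : Token β γ → Token β γ → ℚ, (∀ r c, K r c ≠ 0 → r.2.1 ⊆ c.2.1 ∧ r.2.2 ⊆ c.2.2) ∧
          LinearIndependent ℚ (fun r : ↥(dipoleDem P F) => fun c : ↥(dipoleSup P F) => K r c)) :
    TriWIneq := by
  intro β γ _ _ _ _ P F G hP hF hG hFm hGm
  obtain ⟨K, hK, hli⟩ := h β γ P F hP hF hFm
  exact triW_nonneg_of_dipoleRankCert P F G hG hGm K hK hli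

end FiveUpSet

end Summit.CriticalPhenomena.PercolationContinuityZ3.Theorems
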